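import Literature.Analysis.OperatorTheory.PositivityImproving
import HarnessLib

/-!
# The weighted pairing `∫ f G g dμ` of two real `L²` functions against a bounded weight — PROVED

Topic `Literature/Analysis/OperatorTheory`; `L²` bookkeeping used by the transfer-operator
treatment of periodic (cyclic) kernel chains (`CyclicKernelSpectralBound.lean`): for `f, g` in the
real `Lp ℝ 2 μ` and a bounded measurable weight `G : X → ℝ` (`|G| ≤ B_G`), the pairing
`∫ f(y) G(y) g(y) dμ(y)` — the matrix element `⟪f, M_G g⟫` of the multiplication operator, written
without introducing that operator — is

* well defined (`integrable_coeFn_mul_mul`, Hölder), bounded by `B_G ‖f‖₂ ‖g‖₂`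
  (`abs_integral_mul_mul_le`, Cauchy–Schwarz),
* additive and homogeneous in `f` (`integral_coeFn_add_mul_mul`, `integral_coeFn_smul_mul_mul`) and
  symmetric (`integral_coeFn_mul_mul_comm`),
* and expands under rank-one decompositions `f = c₁φ + r₁`, `g = c₂φ + r₂`
  (`integral_mul_mul_eq_expansion`).

Mathlib + `PositivityImproving.lean` (`inner_eq_integral`, `integrable_mul`) only; no definitions.
[folklore]
-/

noncomputable section

open MeasureTheory Set Filter Function
open scoped RealInnerProductSpace ENNReal

namespace Literature.Analysis.OperatorTheory

variable {X : Type*} [MeasurableSpace X] {μ : Measure X}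

/-! ### The weighted pairing `∫ f G g dμ` of two `L²` functions -/

section Pairing

variable {G : X → ℝ} {BG : ℝ}

/-- `y ↦ f(y) G(y) g(y)` is integrable for `f, g ∈ L²` and bounded measurable `G`. [folklore] -/
theorem integrable_coeFn_mul_mul (hGm : Measurable G) (hGb : ∀ y, ‖G y‖ ≤ BG) (f g : Lp ℝ 2 μ) :
    Integrable (fun y => f y * (G y * g y)) μ := by
  have h := (integrable_mul f g).bdd_mul hGm.aestronglyMeasurable (Eventually.of_forall hGb)
  exact h.congr (Eventually.of_forall fun y => by ring)

/-- **`|∫ f G g dμ| ≤ ‖G‖_∞ ‖f‖₂ ‖g‖₂`** (Cauchy–Schwarz). [folklore] -/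
theorem abs_integral_mul_mul_le (hGb : ∀ y, ‖G y‖ ≤ BG) (hBG : 0 ≤ BG) (f g : Lp ℝ 2 μ) :
    |∫ y, f y * (G y * g y) ∂μ| ≤ BG * ‖f‖ * ‖g‖ := by
  have hint : Integrable (fun y => BG * (|f| y * |g| y)) μ := (integrable_mul |f| |g|).const_mul BG
  calc |∫ y, f y * (G y * g y) ∂μ| ≤ ∫ y, |f y * (G y * g y)| ∂μ := abs_integral_le_integral_abs
    _ ≤ ∫ y, BG * (|f| y * |g| y) ∂μ := by
        refine integral_mono_of_nonneg (Eventually.of_forall fun y => abs_nonneg _) hint ?_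
        filter_upwards [Lp.coeFn_abs f, Lp.coeFn_abs g] with y hf hg
        rw [hf, hg, abs_mul, abs_mul]
        calc |f y| * (|G y| * |g y|) = |G y| * (|f y| * |g y|) := by ring
          _ ≤ BG * (|f y| * |g y|) :=
              mul_le_mul_of_nonneg_right (by simpa [Real.norm_eq_abs] using hGb y) (by positivity)
    _ = BG * ⟪|f|, |g|⟫ := by rw [integral_const_mul, inner_eq_integral]
    _ ≤ BG * (‖|f|‖ * ‖|g|‖) := mul_le_mul_of_nonneg_left (real_inner_le_norm _ _) hBG
    _ = BG * ‖f‖ * ‖g‖ := by rw [norm_abs_eq_norm, norm_abs_eq_norm, mul_assoc]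

/-- Additivity of `∫ f G g` in `f`. [folklore] -/
theorem integral_coeFn_add_mul_mul (hGm : Measurable G) (hGb : ∀ y, ‖G y‖ ≤ BG) (f f' g : Lp ℝ 2 μ) :
    ∫ y, (f + f') y * (G y * g y) ∂μ = ∫ y, f y * (G y * g y) ∂μ + ∫ y, f' y * (G y * g y) ∂μ := by
  rw [← integral_add (integrable_coeFn_mul_mul hGm hGb f g) (integrable_coeFn_mul_mul hGm hGb f' g)]
  refine integral_congr_ae ?_
  filter_upwards [Lp.coeFn_add f f'] with y hy
  rw [hy, Pi.add_apply]
  ring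

/-- Homogeneity of `∫ f G g` in `f`. [folklore] -/
theorem integral_coeFn_smul_mul_mul (c : ℝ) (f g : Lp ℝ 2 μ) :
    ∫ y, (c • f) y * (G y * g y) ∂μ = c * ∫ y, f y * (G y * g y) ∂μ := by
  rw [← integral_const_mul]
  refine integral_congr_ae ?_
  filter_upwards [Lp.coeFn_smul c f] with y hy
  rw [hy, Pi.smul_apply, smul_eq_mul]
  ring

/-- Symmetry of `∫ f G g` in `f, g`. [folklore] -/
theorem integral_coeFn_mul_mul_comm (f g : Lp ℝ 2 μ) :
    ∫ y, f y * (G y * g y) ∂μ = ∫ y, g y * (G y * f y) ∂μ :=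
  integral_congr_ae (Eventually.of_forall fun y => by ring)

/-- **Rank-one expansion of the pairing.** Writing `f = c₁ φ + r₁`, `g = c₂ φ + r₂`,
`∫ f G g = c₁ c₂ ∫ φ G φ + c₁ ∫ φ G r₂ + c₂ ∫ r₁ G φ + ∫ r₁ G r₂`. [folklore] -/
theorem integral_mul_mul_eq_expansion (hGm : Measurable G) (hGb : ∀ y, ‖G y‖ ≤ BG)
    (f g φ : Lp ℝ 2 μ) (c₁ c₂ : ℝ) :
    ∫ y, f y * (G y * g y) ∂μ =
      c₁ * c₂ * ∫ y, φ y * (G y * φ y) ∂μ + c₁ * ∫ y, φ y * (G y * (g - c₂ • φ) y) ∂μ +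
        c₂ * ∫ y, (f - c₁ • φ) y * (G y * φ y) ∂μ +
        ∫ y, (f - c₁ • φ) y * (G y * (g - c₂ • φ) y) ∂μ := by
  have hf : f = c₁ • φ + (f - c₁ • φ) := by abel
  have hg : g = c₂ • φ + (g - c₂ • φ) := by abel
  -- expand in `f`
  have h1 : ∫ y, f y * (G y * g y) ∂μ =
      c₁ * ∫ y, φ y * (G y * g y) ∂μ + ∫ y, (f - c₁ • φ) y * (G y * g y) ∂μ := by
    conv_lhs => rw [hf]
    rw [integral_coeFn_add_mul_mul hGm hGb, integral_coeFn_smul_mul_mul]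
  -- expand in `g` (via symmetry)
  have h2 : ∀ u : Lp ℝ 2 μ, ∫ y, u y * (G y * g y) ∂μ =
      c₂ * ∫ y, u y * (G y * φ y) ∂μ + ∫ y, u y * (G y * (g - c₂ • φ) y) ∂μ := by
    intro u
    rw [integral_coeFn_mul_mul_comm u g]
    conv_lhs => rw [hg]
    rw [integral_coeFn_add_mul_mul hGm hGb, integral_coeFn_smul_mul_mul,
      integral_coeFn_mul_mul_comm φ u, integral_coeFn_mul_mul_comm (g - c₂ • φ) u]
  rw [h1, h2 φ, h2 (f - c₁ • φ)]
  ring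

end Pairing

end Literature.Analysis.OperatorTheory

end
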